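import Summits.AtomisticToContinuum.Crystallization.Theorems.OverbindingBudgetAffineRadialJetA

/-!
# Radial JET tables for the far-core certificate (slot Z, leaf Z2): polynomial jets, the jet model ψ_J, Gram-chart glue with a radius split, (lower) proved, (upper) reduced to the chart, three zones — part 2 of 3 (sequel of `…OverbindingBudgetAffineRadialJetA`)

Split for the 400-line cap by the landing lane (hand-2 g33); the module docstring of part 1 (`…OverbindingBudgetAffineRadialJetA`) describes the whole node.  Same namespace; all FQNs unchanged.
0 sorry; standard axioms.
-/

noncomputable section
open Set

namespace Summit.AtomisticToContinuum.Crystallization.Theorems.OverbindingBudgetAffineRadialJet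

open Literature.MathematicalPhysics.StatisticalMechanics
open Summit.AtomisticToContinuum.Crystallization.Theorems.OverbindingBudgetAffineFarSmoothSplit
open Summit.AtomisticToContinuum.Crystallization.Theorems.OverbindingBudgetAffineRadialReduction
open Summit.AtomisticToContinuum.Crystallization.Theorems.OverbindingBudgetAffineRadialGlue
open Summit.AtomisticToContinuum.Crystallization.Theorems.OverbindingBudgetAffineRadialChart

local notation "E3" => EuclideanSpace ℝ (Fin 3)
local notation "E5" => EuclideanSpace ℝ (Fin 5)

section Reduction

variable {E : Type*} [NormedAddCommGroup E] [NormedSpace ℝ E] {ι : Type*}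
  (D : FamilyData E ι) (J₃ J₆ : JetData E) {K : Set E} {x₀ : E} {ρ ρ₁ m₀ η δ₀ b r₁ : ℝ}

/-- ★ **Radial reduction for the jet model**: `…RadialReduction.radial_reduction` specialised to
`ψ_J = (S₆ + J₆)/(S₃ + J₃)²` on a star-convex region on which the family denominators and `PJ` do not vanish.
(C) `m₀ ≤ psiJ₂` on `K ∩ B(x₀, ρ)`, (B) slope-or-curvature on `K ∖ B(x₀, ρ)`, (G),(0) centre data ⇒ `b ≤ ψ_J` on
`K ∖ B(x₀, r₁)`. [this file] -/
theorem radial_reductionJ (hK : StarConvex ℝ x₀ K)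
    (hpos : ∀ y ∈ K, ∀ i ∈ D.s, D.c i + D.L i y ≠ 0) (hP : ∀ y ∈ K, PJ D J₃ y ≠ 0)
    (hC : ∀ y ∈ K, ‖y - x₀‖ ≤ ρ → ∀ u : E, ‖u‖ = 1 → m₀ ≤ psiJ₂ D J₃ J₆ y u)
    (hB : ∀ y ∈ K, ρ ≤ ‖y - x₀‖ →
      0 < psiJ₁ D J₃ J₆ y (‖y - x₀‖⁻¹ • (y - x₀)) ∨ 0 < psiJ₂ D J₃ J₆ y (‖y - x₀‖⁻¹ • (y - x₀)))
    (hG : ∀ u : E, ‖u‖ = 1 → -η ≤ psiJ₁ D J₃ J₆ x₀ u) (h0 : b - δ₀ ≤ psiJ D J₃ J₆ x₀)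
    (hr₁ : 0 < r₁) (hrρ : r₁ ≤ ρ)
    (hq : ∀ t ∈ Icc r₁ ρ, δ₀ + η * t ≤ m₀ / 2 * t ^ 2) (hρη : η < m₀ * ρ) :
    ∀ x ∈ K, r₁ ≤ ‖x - x₀‖ → b ≤ psiJ D J₃ J₆ x :=
  radial_reduction hK
    (fun y hy u => hasDerivAt_psiJ_line D J₃ J₆ y u (hpos y hy) (hP y hy))
    (fun y hy u => hasDerivAt_psiJ₁_line D J₃ J₆ y u (hpos y hy) (hP y hy)) hC hB hG h0 hr₁ hrρ hq hρη

/-- ★ **Radial reduction with collar for the jet model**: as `radial_reductionJ`, with (B) only on the shell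
`ρ ≤ ‖y − x₀‖ ≤ ρ₁` and the VALUE inequality `b ≤ ψ_J` supplied beyond `ρ₁` (value rows). [this file] -/
theorem radial_reduction_collarJ (hK : StarConvex ℝ x₀ K)
    (hpos : ∀ y ∈ K, ∀ i ∈ D.s, D.c i + D.L i y ≠ 0) (hP : ∀ y ∈ K, PJ D J₃ y ≠ 0)
    (hC : ∀ y ∈ K, ‖y - x₀‖ ≤ ρ → ∀ u : E, ‖u‖ = 1 → m₀ ≤ psiJ₂ D J₃ J₆ y u)
    (hB : ∀ y ∈ K, ρ ≤ ‖y - x₀‖ → ‖y - x₀‖ ≤ ρ₁ →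
      0 < psiJ₁ D J₃ J₆ y (‖y - x₀‖⁻¹ • (y - x₀)) ∨ 0 < psiJ₂ D J₃ J₆ y (‖y - x₀‖⁻¹ • (y - x₀)))
    (hV : ∀ y ∈ K, ρ₁ ≤ ‖y - x₀‖ → b ≤ psiJ D J₃ J₆ y)
    (hG : ∀ u : E, ‖u‖ = 1 → -η ≤ psiJ₁ D J₃ J₆ x₀ u) (h0 : b - δ₀ ≤ psiJ D J₃ J₆ x₀)
    (hr₁ : 0 < r₁) (hrρ : r₁ ≤ ρ) (hρ₁ : 0 ≤ ρ₁)
    (hq : ∀ t ∈ Icc r₁ ρ, δ₀ + η * t ≤ m₀ / 2 * t ^ 2) (hρη : η < m₀ * ρ) :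
    ∀ x ∈ K, r₁ ≤ ‖x - x₀‖ → b ≤ psiJ D J₃ J₆ x :=
  radial_reduction_collar hK
    (fun y hy u => hasDerivAt_psiJ_line D J₃ J₆ y u (hpos y hy) (hP y hy))
    (fun y hy u => hasDerivAt_psiJ₁_line D J₃ J₆ y u (hpos y hy) (hP y hy)) hC hB hV hG h0 hr₁ hrρ hρ₁ hq hρη

end Reduction

/-! ## §4 The Gram-chart glue with a radius split (no (far) obligation) -/

section Split

variable {ι : Type*} {θ' : ℝ} {w : Fin 6 → ℤ}

/-- The scale-free algebra AT A CHART POINT: a far window with the two jet enclosures at its Gram chart point, `PJ > 0`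
there and `b ≤ ψ_J` there satisfies the ratio inequality `b·T₃↑² ≤ T₆↓`. [this file] -/
theorem ratio_of_chartTables {D : FamilyData E5 ι} {J₃ J₆ : JetData E5} {b : ℝ} {X : E3 →ₗ[ℝ] E3}
    (hX : FarWindowData (1 / 25) θ' w X)
    (hupper : chartScale X ^ 6 * windowSixUp w X ≤ PJ D J₃ (gramChart X))
    (hlower : NJ D J₆ (gramChart X) ≤ chartScale X ^ 12 * windowTwelveLo w X)
    (hP : 0 < PJ D J₃ (gramChart X)) (hb : 0 ≤ b) (hψ : b ≤ psiJ D J₃ J₆ (gramChart X)) :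
    b * windowSixUp w X ^ 2 ≤ windowTwelveLo w X :=
  table_of_ratio (scale_pos_of_farWindowData (by norm_num) hX) (windowSixUp_nonneg w X) hb hupper hlower hP
    (by simpa only [psiJ] using hψ)

/-- ★ THE RADIUS SPLIT: the ratio table of a window from a table on the INNER ball `‖gramChart X − x₀‖ < r₁` (any
device — the zone-I/II certificate of the line of record) and a table on the OUTER region `r₁ ≤ ‖gramChart X − x₀‖`.
[this file] -/
theorem table_of_split {b r₁ : ℝ} {x₀ : E5}
    (hinner : ∀ X : E3 →ₗ[ℝ] E3, FarWindowData (1 / 25) θ' w X → ‖gramChart X - x₀‖ < r₁ →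
      b * windowSixUp w X ^ 2 ≤ windowTwelveLo w X)
    (houter : ∀ X : E3 →ₗ[ℝ] E3, FarWindowData (1 / 25) θ' w X → r₁ ≤ ‖gramChart X - x₀‖ →
      b * windowSixUp w X ^ 2 ≤ windowTwelveLo w X) :
    ∀ X : E3 →ₗ[ℝ] E3, FarWindowData (1 / 25) θ' w X → b * windowSixUp w X ^ 2 ≤ windowTwelveLo w X :=
  fun X hX => (lt_or_ge ‖gramChart X - x₀‖ r₁).elim (hinner X hX) (houter X hX)

/-- The (far) route of generation 68 is the special case «inner table vacuous»: if the far clause excludes the Gram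
ball of radius `r₁`, any inequality holds on it. [formal bookkeeping] -/
theorem inner_of_far {b r₁ : ℝ} {x₀ : E5}
    (hfar : ∀ X : E3 →ₗ[ℝ] E3, FarWindowData (1 / 25) θ' w X → r₁ ≤ ‖gramChart X - x₀‖) :
    ∀ X : E3 →ₗ[ℝ] E3, FarWindowData (1 / 25) θ' w X → ‖gramChart X - x₀‖ < r₁ →
      b * windowSixUp w X ^ 2 ≤ windowTwelveLo w X :=
  fun X hX hlt => absurd (hfar X hX) (not_le.2 hlt)

variable {D : FamilyData E5 ι} {J₃ J₆ : JetData E5} {x₀ : E5} {ρ ρ₁ m₀ η δ₀ b r₁ : ℝ}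

/-- ★★ **The OUTER table of a window from the jet radial tables.**  The two jet enclosures (upper-J)/(lower-J) of the
window at every admissible `X` whose chart point lies outside `B(x₀, r₁)`, a centre `x₀ ∈ KRegion (196/121)`,
non-vanishing of the family and positivity of `PJ` on the region, the radial tables (C)/(B)/(G),(0) of `ψ_J` and the
side conditions ⇒ `b·T₃↑² ≤ T₆↓` for every such `X`. [this file] -/
theorem outerTable_of_radialTablesJ
    (hupper : ∀ X : E3 →ₗ[ℝ] E3, FarWindowData (1 / 25) θ' w X → r₁ ≤ ‖gramChart X - x₀‖ →
      chartScale X ^ 6 * windowSixUp w X ≤ PJ D J₃ (gramChart X))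
    (hlower : ∀ X : E3 →ₗ[ℝ] E3, FarWindowData (1 / 25) θ' w X → r₁ ≤ ‖gramChart X - x₀‖ →
      NJ D J₆ (gramChart X) ≤ chartScale X ^ 12 * windowTwelveLo w X)
    (hx₀ : x₀ ∈ KRegion (196 / 121))
    (hpos : ∀ y ∈ KRegion (196 / 121), ∀ i ∈ D.s, D.c i + D.L i y ≠ 0)
    (hP : ∀ y ∈ KRegion (196 / 121), 0 < PJ D J₃ y)
    (hC : ∀ y ∈ KRegion (196 / 121), ‖y - x₀‖ ≤ ρ → ∀ u : E5, ‖u‖ = 1 → m₀ ≤ psiJ₂ D J₃ J₆ y u)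
    (hB : ∀ y ∈ KRegion (196 / 121), ρ ≤ ‖y - x₀‖ →
      0 < psiJ₁ D J₃ J₆ y (‖y - x₀‖⁻¹ • (y - x₀)) ∨ 0 < psiJ₂ D J₃ J₆ y (‖y - x₀‖⁻¹ • (y - x₀)))
    (hG : ∀ u : E5, ‖u‖ = 1 → -η ≤ psiJ₁ D J₃ J₆ x₀ u) (h0 : b - δ₀ ≤ psiJ D J₃ J₆ x₀)
    (hr₁ : 0 < r₁) (hrρ : r₁ ≤ ρ)
    (hq : ∀ t ∈ Icc r₁ ρ, δ₀ + η * t ≤ m₀ / 2 * t ^ 2) (hρη : η < m₀ * ρ) (hb : 0 ≤ b) :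
    ∀ X : E3 →ₗ[ℝ] E3, FarWindowData (1 / 25) θ' w X → r₁ ≤ ‖gramChart X - x₀‖ →
      b * windowSixUp w X ^ 2 ≤ windowTwelveLo w X := by
  intro X hX hr
  have hxK : gramChart X ∈ KRegion (196 / 121) := mem_K_record hX
  have hψ := radial_reductionJ D J₃ J₆ (starConvex_KRegion _ hx₀) hpos (fun y hy => (hP y hy).ne') hC hB hG h0
    hr₁ hrρ hq hρη (gramChart X) hxK hr
  exact ratio_of_chartTables hX (hupper X hX hr) (hlower X hX hr) (hP _ hxK) hb hψ

/-- ★★ **The OUTER table from the jet radial tables WITH COLLAR** (derivative rows on the core `‖· − x₀‖ ≤ ρ₁`, value rows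
beyond). [this file] -/
theorem outerTable_of_collarTablesJ
    (hupper : ∀ X : E3 →ₗ[ℝ] E3, FarWindowData (1 / 25) θ' w X → r₁ ≤ ‖gramChart X - x₀‖ →
      chartScale X ^ 6 * windowSixUp w X ≤ PJ D J₃ (gramChart X))
    (hlower : ∀ X : E3 →ₗ[ℝ] E3, FarWindowData (1 / 25) θ' w X → r₁ ≤ ‖gramChart X - x₀‖ →
      NJ D J₆ (gramChart X) ≤ chartScale X ^ 12 * windowTwelveLo w X)
    (hx₀ : x₀ ∈ KRegion (196 / 121))
    (hpos : ∀ y ∈ KRegion (196 / 121), ∀ i ∈ D.s, D.c i + D.L i y ≠ 0)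
    (hP : ∀ y ∈ KRegion (196 / 121), 0 < PJ D J₃ y)
    (hC : ∀ y ∈ KRegion (196 / 121), ‖y - x₀‖ ≤ ρ → ∀ u : E5, ‖u‖ = 1 → m₀ ≤ psiJ₂ D J₃ J₆ y u)
    (hB : ∀ y ∈ KRegion (196 / 121), ρ ≤ ‖y - x₀‖ → ‖y - x₀‖ ≤ ρ₁ →
      0 < psiJ₁ D J₃ J₆ y (‖y - x₀‖⁻¹ • (y - x₀)) ∨ 0 < psiJ₂ D J₃ J₆ y (‖y - x₀‖⁻¹ • (y - x₀)))
    (hV : ∀ y ∈ KRegion (196 / 121), ρ₁ ≤ ‖y - x₀‖ → b ≤ psiJ D J₃ J₆ y)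
    (hG : ∀ u : E5, ‖u‖ = 1 → -η ≤ psiJ₁ D J₃ J₆ x₀ u) (h0 : b - δ₀ ≤ psiJ D J₃ J₆ x₀)
    (hr₁ : 0 < r₁) (hrρ : r₁ ≤ ρ) (hρ₁ : 0 ≤ ρ₁)
    (hq : ∀ t ∈ Icc r₁ ρ, δ₀ + η * t ≤ m₀ / 2 * t ^ 2) (hρη : η < m₀ * ρ) (hb : 0 ≤ b) :
    ∀ X : E3 →ₗ[ℝ] E3, FarWindowData (1 / 25) θ' w X → r₁ ≤ ‖gramChart X - x₀‖ →
      b * windowSixUp w X ^ 2 ≤ windowTwelveLo w X := by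
  intro X hX hr
  have hxK : gramChart X ∈ KRegion (196 / 121) := mem_K_record hX
  have hψ := radial_reduction_collarJ D J₃ J₆ (starConvex_KRegion _ hx₀) hpos (fun y hy => (hP y hy).ne') hC hB hV
    hG h0 hr₁ hrρ hρ₁ hq hρη (gramChart X) hxK hr
  exact ratio_of_chartTables hX (hupper X hX hr) (hlower X hX hr) (hP _ hxK) hb hψ

/-- ◇ **The OUTER table from a VALUE table of `ψ_J`** (the line of record may use the same jet model: its Taylor value
rows then need no far-field rows of their own). [this file] -/
theorem outerTable_of_valueTableJ
    (hupper : ∀ X : E3 →ₗ[ℝ] E3, FarWindowData (1 / 25) θ' w X → r₁ ≤ ‖gramChart X - x₀‖ →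
      chartScale X ^ 6 * windowSixUp w X ≤ PJ D J₃ (gramChart X))
    (hlower : ∀ X : E3 →ₗ[ℝ] E3, FarWindowData (1 / 25) θ' w X → r₁ ≤ ‖gramChart X - x₀‖ →
      NJ D J₆ (gramChart X) ≤ chartScale X ^ 12 * windowTwelveLo w X)
    (hP : ∀ y ∈ KRegion (196 / 121), 0 < PJ D J₃ y)
    (hval : ∀ y ∈ KRegion (196 / 121), r₁ ≤ ‖y - x₀‖ → b ≤ psiJ D J₃ J₆ y) (hb : 0 ≤ b) :
    ∀ X : E3 →ₗ[ℝ] E3, FarWindowData (1 / 25) θ' w X → r₁ ≤ ‖gramChart X - x₀‖ →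
      b * windowSixUp w X ^ 2 ≤ windowTwelveLo w X := by
  intro X hX hr
  have hxK : gramChart X ∈ KRegion (196 / 121) := mem_K_record hX
  exact ratio_of_chartTables hX (hupper X hX hr) (hlower X hX hr) (hP _ hxK) hb (hval _ hxK hr)

end Split

/-! ## §5 End to end: Z2 from the inner tables and the jet tables of all windows -/

section EndToEnd

variable {ι : Type*} {c τ l3 L6hi b : ℝ}
  {D : (Fin 6 → ℤ) → FamilyData E5 ι} {J₃ J₆ : (Fin 6 → ℤ) → JetData E5} {x₀ : (Fin 6 → ℤ) → E5}
  {ρ ρ₁ m₀ η δ₀ r₁ : (Fin 6 → ℤ) → ℝ}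

/-- ★★★ **Z2 `FarCoreExcess (1/25) (1/2000) (1/(2·10⁷))` from the radius-split jet tables.**  For every sign window `w`:
an INNER table on the Gram ball `B(x₀ w, r₁ w)` (the zone-I/II device of the line of record, or `inner_of_far`), the jet
enclosures (upper-J)/(lower-J) outside it, a centre `x₀ w ∈ KRegion (196/121)`, the radial tables (C)/(B)/(G),(0) of `ψ_J`
on `KRegion (196/121)`, the side conditions, `0 ≤ b`, `L6hi ≤ b·(l3² − 24κ″L6hi)` and the hcp enclosures.
[this file] -/
theorem farCoreExcess_of_splitJetTables (hc : c ≠ 0) (hτ : 0 < τ) (hτ' : τ ≤ 1 / 100)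
    (hl3 : 0 < l3) (hL3 : l3 ≤ StackingSums.hcpInvPowSum 3 c) (hL6 : StackingSums.hcpInvPowSum 6 c ≤ L6hi)
    (hκ : 24 * (1 / (2 * 10 ^ 7) + 1 / 10 ^ 9) * L6hi ≤ l3 ^ 2)
    (hinner : ∀ w, ∀ X : E3 →ₗ[ℝ] E3, FarWindowData (1 / 25) (1 / 2000 - τ) w X → ‖gramChart X - x₀ w‖ < r₁ w →
      b * windowSixUp w X ^ 2 ≤ windowTwelveLo w X)
    (hupper : ∀ w, ∀ X : E3 →ₗ[ℝ] E3, FarWindowData (1 / 25) (1 / 2000 - τ) w X → r₁ w ≤ ‖gramChart X - x₀ w‖ →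
      chartScale X ^ 6 * windowSixUp w X ≤ PJ (D w) (J₃ w) (gramChart X))
    (hlower : ∀ w, ∀ X : E3 →ₗ[ℝ] E3, FarWindowData (1 / 25) (1 / 2000 - τ) w X → r₁ w ≤ ‖gramChart X - x₀ w‖ →
      NJ (D w) (J₆ w) (gramChart X) ≤ chartScale X ^ 12 * windowTwelveLo w X)
    (hx₀ : ∀ w, x₀ w ∈ KRegion (196 / 121))
    (hpos : ∀ w, ∀ y ∈ KRegion (196 / 121), ∀ i ∈ (D w).s, (D w).c i + (D w).L i y ≠ 0)
    (hP : ∀ w, ∀ y ∈ KRegion (196 / 121), 0 < PJ (D w) (J₃ w) y)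
    (hC : ∀ w, ∀ y ∈ KRegion (196 / 121), ‖y - x₀ w‖ ≤ ρ w → ∀ u : E5, ‖u‖ = 1 →
      m₀ w ≤ psiJ₂ (D w) (J₃ w) (J₆ w) y u)
    (hB : ∀ w, ∀ y ∈ KRegion (196 / 121), ρ w ≤ ‖y - x₀ w‖ →
      0 < psiJ₁ (D w) (J₃ w) (J₆ w) y (‖y - x₀ w‖⁻¹ • (y - x₀ w)) ∨
        0 < psiJ₂ (D w) (J₃ w) (J₆ w) y (‖y - x₀ w‖⁻¹ • (y - x₀ w)))
    (hG : ∀ w, ∀ u : E5, ‖u‖ = 1 → -η w ≤ psiJ₁ (D w) (J₃ w) (J₆ w) (x₀ w) u)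
    (h0 : ∀ w, b - δ₀ w ≤ psiJ (D w) (J₃ w) (J₆ w) (x₀ w))
    (hr₁ : ∀ w, 0 < r₁ w) (hrρ : ∀ w, r₁ w ≤ ρ w)
    (hq : ∀ w, ∀ t ∈ Icc (r₁ w) (ρ w), δ₀ w + η w * t ≤ m₀ w / 2 * t ^ 2) (hρη : ∀ w, η w < m₀ w * ρ w)
    (hb : 0 ≤ b) (hbD : L6hi ≤ b * (l3 ^ 2 - 24 * (1 / (2 * 10 ^ 7) + 1 / 10 ^ 9) * L6hi)) :
    FarCoreExcess (1 / 25) (1 / 2000) (1 / (2 * 10 ^ 7)) :=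
  farCoreExcess_of_ratioTables hc hτ hτ' hl3 hL3 hL6 hκ
    (fun w => table_of_split (hinner w) (outerTable_of_radialTablesJ (hupper w) (hlower w) (hx₀ w) (hpos w) (hP w)
      (hC w) (hB w) (hG w) (h0 w) (hr₁ w) (hrρ w) (hq w) (hρη w) hb)) hbD

/-- ★★★ **Z2 from the radius-split jet tables WITH COLLAR** (derivative rows on the cores, value rows beyond `ρ₁ w`).
[this file] -/
theorem farCoreExcess_of_splitCollarJetTables (hc : c ≠ 0) (hτ : 0 < τ) (hτ' : τ ≤ 1 / 100)
    (hl3 : 0 < l3) (hL3 : l3 ≤ StackingSums.hcpInvPowSum 3 c) (hL6 : StackingSums.hcpInvPowSum 6 c ≤ L6hi)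
    (hκ : 24 * (1 / (2 * 10 ^ 7) + 1 / 10 ^ 9) * L6hi ≤ l3 ^ 2)
    (hinner : ∀ w, ∀ X : E3 →ₗ[ℝ] E3, FarWindowData (1 / 25) (1 / 2000 - τ) w X → ‖gramChart X - x₀ w‖ < r₁ w →
      b * windowSixUp w X ^ 2 ≤ windowTwelveLo w X)
    (hupper : ∀ w, ∀ X : E3 →ₗ[ℝ] E3, FarWindowData (1 / 25) (1 / 2000 - τ) w X → r₁ w ≤ ‖gramChart X - x₀ w‖ →
      chartScale X ^ 6 * windowSixUp w X ≤ PJ (D w) (J₃ w) (gramChart X))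
    (hlower : ∀ w, ∀ X : E3 →ₗ[ℝ] E3, FarWindowData (1 / 25) (1 / 2000 - τ) w X → r₁ w ≤ ‖gramChart X - x₀ w‖ →
      NJ (D w) (J₆ w) (gramChart X) ≤ chartScale X ^ 12 * windowTwelveLo w X)
    (hx₀ : ∀ w, x₀ w ∈ KRegion (196 / 121))
    (hpos : ∀ w, ∀ y ∈ KRegion (196 / 121), ∀ i ∈ (D w).s, (D w).c i + (D w).L i y ≠ 0)
    (hP : ∀ w, ∀ y ∈ KRegion (196 / 121), 0 < PJ (D w) (J₃ w) y)
    (hC : ∀ w, ∀ y ∈ KRegion (196 / 121), ‖y - x₀ w‖ ≤ ρ w → ∀ u : E5, ‖u‖ = 1 →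
      m₀ w ≤ psiJ₂ (D w) (J₃ w) (J₆ w) y u)
    (hB : ∀ w, ∀ y ∈ KRegion (196 / 121), ρ w ≤ ‖y - x₀ w‖ → ‖y - x₀ w‖ ≤ ρ₁ w →
      0 < psiJ₁ (D w) (J₃ w) (J₆ w) y (‖y - x₀ w‖⁻¹ • (y - x₀ w)) ∨
        0 < psiJ₂ (D w) (J₃ w) (J₆ w) y (‖y - x₀ w‖⁻¹ • (y - x₀ w)))
    (hV : ∀ w, ∀ y ∈ KRegion (196 / 121), ρ₁ w ≤ ‖y - x₀ w‖ → b ≤ psiJ (D w) (J₃ w) (J₆ w) y)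
    (hG : ∀ w, ∀ u : E5, ‖u‖ = 1 → -η w ≤ psiJ₁ (D w) (J₃ w) (J₆ w) (x₀ w) u)
    (h0 : ∀ w, b - δ₀ w ≤ psiJ (D w) (J₃ w) (J₆ w) (x₀ w))
    (hr₁ : ∀ w, 0 < r₁ w) (hrρ : ∀ w, r₁ w ≤ ρ w) (hρ₁ : ∀ w, 0 ≤ ρ₁ w)
    (hq : ∀ w, ∀ t ∈ Icc (r₁ w) (ρ w), δ₀ w + η w * t ≤ m₀ w / 2 * t ^ 2) (hρη : ∀ w, η w < m₀ w * ρ w)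
    (hb : 0 ≤ b) (hbD : L6hi ≤ b * (l3 ^ 2 - 24 * (1 / (2 * 10 ^ 7) + 1 / 10 ^ 9) * L6hi)) :
    FarCoreExcess (1 / 25) (1 / 2000) (1 / (2 * 10 ^ 7)) :=
  farCoreExcess_of_ratioTables hc hτ hτ' hl3 hL3 hL6 hκ
    (fun w => table_of_split (hinner w) (outerTable_of_collarTablesJ (hupper w) (hlower w) (hx₀ w) (hpos w) (hP w)
      (hC w) (hB w) (hV w) (hG w) (h0 w) (hr₁ w) (hrρ w) (hρ₁ w) (hq w) (hρη w) hb)) hbD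

end EndToEnd

/-! ## §6 The (lower) obligation PROVED for a window-indexed family and a constant non-positive twelve-sum far field

For the sixth-power (chart: `N`) side no far-field jet is needed (the far field is `≤ 5·10⁻⁷` in value and `≤ 3·10⁻⁶` in
gradient, memo §1): DROPPING it (`J₆ = const F₆`, `F₆ ≤ 0`) keeps `NJ` a lower model.  For a family indexed by lattice
triples `t = (k, i, j)` of the seven window layers `|k| ≤ 3` whose affine denominators ARE the chart forms
`c_t + L_t(y) = chartForm y (wIdx w t)`, the obligation (lower-J) then holds at EVERY admissible `X` (no radius condition):
finite partial sums of the non-negative layer terms are below the layer sums (`…FarCoreWindowsA.summable_shapeFamily`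
through a Hägg sequence extending the window), the seven window layers are below `T₆↓` (`…FarCoreWindowsB.summable_layerUp_layerLo`),
and `‖X (wPos w t)‖² = chartScale X² · chartForm (gramChart X) (wIdx w t)` (`…RadialChart.normSq_redVec_eq_chart`). -/

section LowerZero

/-- A `±1` sequence extending a sign window (`s(i − 3) = w i` for `i < 6`, `1` elsewhere). -/
def seqOfWindow (w : Fin 6 → ℤ) : ℤ → ℤ := fun j =>
  if h : -3 ≤ j ∧ j < 3 then w ⟨(j + 3).toNat, by omega⟩ else 1

/-- `windowOf_seqOfWindow` (docstring added by the landing lane; see the module docstring). [formal bookkeeping] -/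
theorem windowOf_seqOfWindow (w : Fin 6 → ℤ) : windowOf (seqOfWindow w) = w := by
  funext i
  have hi := i.2
  unfold windowOf seqOfWindow
  rw [dif_pos ⟨by omega, by omega⟩]
  congr 1
  apply Fin.ext
  dsimp only
  omega

/-- `isHaggSeq_seqOfWindow` (docstring added by the landing lane; see the module docstring). [formal bookkeeping] -/
theorem isHaggSeq_seqOfWindow {w : Fin 6 → ℤ} (hw : ∀ i, w i = 1 ∨ w i = -1) : IsHaggSeq (seqOfWindow w) := by
  intro j
  unfold seqOfWindow
  split_ifs
  · exact hw _
  · exact Or.inl rfl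

/-- `haggLabel_seqOfWindow` (docstring added by the landing lane; see the module docstring). [formal bookkeeping] -/
theorem haggLabel_seqOfWindow (w : Fin 6 → ℤ) {k : ℤ} (hk : |k| ≤ 3) : haggLabel (seqOfWindow w) k = windowLabel w k := by
  rw [haggLabel_eq_windowLabel _ hk, windowOf_seqOfWindow]

variable {θ' : ℝ} {w : Fin 6 → ℤ}

/-- `k ↦ layerLo w X 12 k` is summable for the data of a far window (`θ = 1/25`). [this file] -/
theorem summable_layerLo_of_farWindowData {X : E3 →ₗ[ℝ] E3} (hX : FarWindowData (1 / 25) θ' w X) :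
    Summable fun k : ℤ => layerLo w X 12 k := by
  have h := (summable_layerUp_layerLo (isHaggSeq_seqOfWindow hX.1) (by norm_num : (3 : ℝ) * (1 / 25) ≤ 1 / 6) hX.2.1).2
  rwa [windowOf_seqOfWindow] at h

/-- The seven window layers are below `T₆↓`: `Σ_{|k|≤3} layerSum X 12 k (windowLabel w k) ≤ windowTwelveLo w X`. [this file] -/
theorem sum_window_layers_le_windowTwelveLo {X : E3 →ₗ[ℝ] E3} (hX : FarWindowData (1 / 25) θ' w X) :
    ∑ k ∈ Finset.Icc (-3 : ℤ) 3, layerSum X 12 k (windowLabel w k) ≤ windowTwelveLo w X := by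
  have hle := (summable_layerLo_of_farWindowData hX).sum_le_tsum (Finset.Icc (-3 : ℤ) 3)
    fun k _ => layerLo_nonneg w X 12 k
  unfold windowTwelveLo
  refine le_trans (le_of_eq ?_) hle
  refine Finset.sum_congr rfl fun k hk => ?_
  rw [Finset.mem_Icc] at hk
  unfold layerLo
  rw [if_pos (abs_le.2 ⟨hk.1, hk.2⟩)]

/-- ★ Finite partial sums of window-layer terms are below `T₆↓`: for every finite set `S` of lattice triples in the window
layers `|k| ≤ 3`, `Σ_{t∈S} layerTerm X 12 t.1 (windowLabel w t.1) t.2 ≤ windowTwelveLo w X`. [this file] -/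
theorem sum_layerTerm_le_windowTwelveLo {X : E3 →ₗ[ℝ] E3} (hX : FarWindowData (1 / 25) θ' w X)
    (S : Finset (ℤ × ℤ × ℤ)) (hS : ∀ t ∈ S, |t.1| ≤ 3) :
    ∑ t ∈ S, layerTerm X 12 t.1 (windowLabel w t.1) t.2 ≤ windowTwelveLo w X := by
  have hs : IsHaggSeq (seqOfWindow w) := isHaggSeq_seqOfWindow hX.1
  have hm : (3 : ℝ) * (1 / 25) ≤ 1 / 6 := by norm_num
  obtain ⟨-, h12⟩ := summable_shapeFamily hs hm hX.2.1
  set f : ℤ × ℤ × ℤ → ℝ := fun t =>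
    if |t.1| ≤ 3 then layerTerm X 12 t.1 (haggLabel (seqOfWindow w) t.1) t.2 else 0 with hf
  have hf0 : ∀ t, 0 ≤ f t := fun t => by
    simp only [hf]
    split_ifs
    · exact layerTerm_nonneg _ _ _ _ _
    · exact le_rfl
  have hfle : ∀ t, f t ≤ layerTerm X 12 t.1 (haggLabel (seqOfWindow w) t.1) t.2 := fun t => by
    simp only [hf]
    split_ifs
    · exact le_rfl
    · exact layerTerm_nonneg _ _ _ _ _
  have hfs : Summable f := Summable.of_nonneg_of_le hf0 hfle h12
  have h1 : ∑ t ∈ S, layerTerm X 12 t.1 (windowLabel w t.1) t.2 = ∑ t ∈ S, f t :=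
    Finset.sum_congr rfl fun t ht => by
      simp only [hf, if_pos (hS t ht), haggLabel_seqOfWindow w (hS t ht)]
  have h2 : ∑ t ∈ S, f t ≤ ∑' t, f t := hfs.sum_le_tsum S fun t _ => hf0 t
  have h4 : ∀ k : ℤ, ∑' ij : ℤ × ℤ, f (k, ij) = if |k| ≤ 3 then layerSum X 12 k (windowLabel w k) else 0 := by
    intro k
    by_cases hk : |k| ≤ 3
    · simp only [hf, if_pos hk, haggLabel_seqOfWindow w hk]
      rfl
    · simp only [hf, if_neg hk, tsum_zero]
  have h5 : ∑' k : ℤ, (if |k| ≤ 3 then layerSum X 12 k (windowLabel w k) else 0) =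
      ∑ k ∈ Finset.Icc (-3 : ℤ) 3, layerSum X 12 k (windowLabel w k) := by
    rw [tsum_eq_sum (s := Finset.Icc (-3 : ℤ) 3) (fun k hk => by
      rw [Finset.mem_Icc] at hk
      exact if_neg fun h => hk (abs_le.1 h))]
    refine Finset.sum_congr rfl fun k hk => ?_
    rw [Finset.mem_Icc] at hk
    rw [if_pos (abs_le.2 ⟨hk.1, hk.2⟩)]
  calc ∑ t ∈ S, layerTerm X 12 t.1 (windowLabel w t.1) t.2 = ∑ t ∈ S, f t := h1
    _ ≤ ∑' t, f t := h2
    _ = ∑' k : ℤ, ∑' ij : ℤ × ℤ, f (k, ij) := hfs.tsum_prod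
    _ = ∑' k : ℤ, (if |k| ≤ 3 then layerSum X 12 k (windowLabel w k) else 0) := tsum_congr h4
    _ = ∑ k ∈ Finset.Icc (-3 : ℤ) 3, layerSum X 12 k (windowLabel w k) := h5
    _ ≤ windowTwelveLo w X := sum_window_layers_le_windowTwelveLo hX

/-- The chart identity per family term: `chartScale X¹² · layerTerm X 12 k o (i,j) = (chartForm (gramChart X) (wIdx w t))⁻⁶` for
`t = (k, i, j)`, `o = windowLabel w k`. [this file] -/
theorem scale_pow_mul_layerTerm_eq {X : E3 →ₗ[ℝ] E3} (hs : chartScale X ≠ 0) (t : ℤ × ℤ × ℤ) :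
    chartScale X ^ 12 * layerTerm X 12 t.1 (windowLabel w t.1) t.2 = ((chartForm (gramChart X) (wIdx w t)) ^ 6)⁻¹ := by
  have e1 : layerTerm X 12 t.1 (windowLabel w t.1) t.2 = (‖X (wPos w t)‖)⁻¹ ^ 12 := rfl
  have e2 : ‖X (wPos w t)‖ ^ 2 = chartScale X ^ 2 * chartForm (gramChart X) (wIdx w t) := by
    rw [wPos_eq_redVec, normSq_redVec_eq_chart hs]
  have e3 : (‖X (wPos w t)‖)⁻¹ ^ 12 = ((‖X (wPos w t)‖ ^ 2) ^ 6)⁻¹ := by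
    rw [inv_pow, ← pow_mul]
  rw [e1, e3, e2, mul_pow, ← pow_mul, mul_inv, ← mul_assoc, mul_inv_cancel₀ (pow_ne_zero _ hs), one_mul]

/-- ★★ **(lower-J) PROVED for the constant non-positive twelve-sum jet and a window-indexed family.**  If the family `D` on
`E5` is indexed by lattice triples of the window layers (`|t.1| ≤ 3` on `D.s`) with denominators the chart forms
(`D.c t + D.L t y = chartForm y (wIdx w t)`), and `F₆ ≤ 0`, then at every admissible `X`
`NJ D (const x₆ F₆) (gramChart X) ≤ chartScale X¹² · T₆↓(w, X)`. [this file] -/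
theorem lower_of_windowFamily (D : FamilyData E5 (ℤ × ℤ × ℤ)) (hDs : ∀ t ∈ D.s, |t.1| ≤ 3)
    (hD : ∀ t ∈ D.s, ∀ y : E5, D.c t + D.L t y = chartForm y (wIdx w t)) {x₆ : E5} {F₆ : ℝ} (hF₆ : F₆ ≤ 0)
    {X : E3 →ₗ[ℝ] E3} (hX : FarWindowData (1 / 25) θ' w X) :
    NJ D (JetData.const x₆ F₆) (gramChart X) ≤ chartScale X ^ 12 * windowTwelveLo w X := by
  have hs : 0 < chartScale X := scale_pos_of_farWindowData (by norm_num) hX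
  have hsum : D.S 5 (gramChart X) = chartScale X ^ 12 * ∑ t ∈ D.s, layerTerm X 12 t.1 (windowLabel w t.1) t.2 := by
    unfold FamilyData.S
    rw [Finset.mul_sum]
    refine Finset.sum_congr rfl fun t ht => ?_
    rw [hD t ht, scale_pow_mul_layerTerm_eq hs.ne' t]
  have hNJ : NJ D (JetData.const x₆ F₆) (gramChart X) = D.S 5 (gramChart X) + F₆ := by
    simp only [NJ, JetData.eval_const]
  rw [hNJ, hsum]
  have h := sum_layerTerm_le_windowTwelveLo hX D.s hDs
  nlinarith [pow_pos hs 12]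

/-- ★★ The per-window (lower-J) OBLIGATION of `farCoreExcess_of_splitJetTables` discharged for such families (the radius
hypothesis is not even used). [this file] -/
theorem hlower_of_windowFamily (D : FamilyData E5 (ℤ × ℤ × ℤ)) (hDs : ∀ t ∈ D.s, |t.1| ≤ 3)
    (hD : ∀ t ∈ D.s, ∀ y : E5, D.c t + D.L t y = chartForm y (wIdx w t)) {x₆ : E5} {F₆ : ℝ} (hF₆ : F₆ ≤ 0)
    (x₀ : E5) (r₁ : ℝ) :
    ∀ X : E3 →ₗ[ℝ] E3, FarWindowData (1 / 25) θ' w X → r₁ ≤ ‖gramChart X - x₀‖ →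
      NJ D (JetData.const x₆ F₆) (gramChart X) ≤ chartScale X ^ 12 * windowTwelveLo w X :=
  fun _ hX _ => lower_of_windowFamily D hDs hD hF₆ hX

end LowerZero

end Summit.AtomisticToContinuum.Crystallization.Theorems.OverbindingBudgetAffineRadialJet

end
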